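import Literature.IUT.HodgeArakelov.MonoThetaFromGroupsProp13Genuine
import Literature.IUT.HodgeArakelov.MonoThetaFromGroupsProofsTate
import Literature.AnabelianGeometry.EtaleTheta.Discharge.Sec5FactsMembersOfConnectedTemperoidYdd
import Literature.AnabelianGeometry.EtaleTheta.Discharge.Sec2RigidRowsAtModelTateInr

/-!
# [IUTchII] Prop. 1.2 (ii) / Prop. 1.3 (i): the `M^Θ(𝒞) = E^Π_N` closers RE-CLOSED at (genuine [EtTh] §5 data, Tate instance) (C-R33 / K4)

S. Mochizuki, *Inter-universal Teichmüller theory II*, kurims manuscript (Dec. 2020), §1, Prop. 1.2 (ii) pp. 25–26,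
Prop. 1.3 (i)(ii) p. 26 ([IUTchII] Prop 1.2 (ii) / Prop 1.3 (i), kurims pp.25-26) [claim: Mochizuki2012, status: disputed]
(D-0012 claim key; the series is DISPUTED; nothing printed is asserted here); S. Mochizuki, *The étale theta function …*
[EtTh], Publ. RIMS 45 (2009), §5 Lemma 5.8 / 5.9 pp. 331–332, §2 Cor. 2.18 (ii)/(iv) pp. 60–61 (refereed; inputs BY NAME).

abc-iut cell, sub-cell L-K/R-C (D-0079), seat abc-iut-w4-d009 gen 7, row «K4-RECLOSE-L6-BiThetaFamily» (abc-iut-L6-lead gen 6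
GO, §F v1.19bi (4), 2026-08-26T19:30:40Z).  RULING C-R33 (abc-iut-plan g9): a cone node whose closing theorem binds a
FACT-LIST row of class «refuted-closure» is discharged VACUOUSLY-AS-TYPED until re-closed against the row's surviving
instance form.  Nodes `IUTchII:Prop1.2(ii)` and `IUTchII:Prop1.3(i)` are classed BLOCKED in abc-iut-c312-2's
`CONE-K4-RECLOSE.tsv` v3/v4: their closers of the `M^Θ(𝒞) = E^Π_N` family (abc-iut-w4-d042,
`MonoThetaFromGroupsProp13Genuine`: `envOfBiTheta_toEtale`, `mem_ofBiTheta_extCyc_iff`, `muIncl_corrExtOfBiTheta`,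
`ofBiTheta_extCyc_eq_ker_toPiY`, `ofBiTheta_extCyc_eq_range_muIncl`, `prop13_i_ii_ofBiTheta`; and abc-iut-w4-d042's
`exists_envOfFrobenioid_of_isMonoThetaEnv`, `MonoThetaFromGroupsProofsTate`) bind the [EtTh] §5 schema rows
F-0542 `SectionsFactor` (`h1`), F-0738 `SgpCapSection` (`hsec`), F-0543 `SgpCupSection` (`hcs`), F-0536
`ConstantsEqNormalizer` (`h8`) on an ABSTRACT theta Frobenioid `𝔉`, the [EtTh] §2 rows F-0635 `ThetaEnvData.Cor218_ii`
(`h218ii`) / F-0624 `RigidData.Cor218_iv_fibre` (`hfib`) on an ABSTRACT rigidity datum `R`, and the 17:15Z producers scan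
found no closed producer for F-0635 (and only toy producers for F-0536).

THIS PROOF-ONLY FILE (no `def`, no Prop fact, no `instance`, no `sorry`) re-closes the seven closers at ONE coherent pair
of carriers where every one of those rows is a THEOREM of the tree with no FACT-LIST binder:
* `𝔉 :=` abc-iut-L2-t4's GENUINE [EtTh] §5 data over the connected temperoid `B^temp(Π^tp_X)⁰` with `A_⊙^bs := Ÿ`,
  `ThetaFrobenioid.ofConnectedTemperoidData h Q odd_l R ιX K' constEmb …` (`Discharge/Sec5OfConnectedTemperoid`), where
  Lemma 5.8 / 5.9 (i)(ii) and the two section properties are abc-iut-w6-d053's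
  `ThetaFrobenioid.lem58_lem59_ofConnectedTemperoidYddData` modulo the two printed STRUCTURAL inputs `hconst` (Def. 3.6
  (iii): automorphisms fix the constants) and `hgc` (Lemma 5.8's geometric-connectedness step), and `OuterActionLZ` is
  abc-iut-L2-t4's binder-free `ThetaFrobenioid.outerActionLZ_of`;
* `R :=` abc-iut-L2-t8's rigidity datum `C.rigidData μ …` of an `X̲̲`-choice `C` over abc-iut-w5-d171's étale-theta datum
  OF RECORD `etaleThetaDataχqInr p` at the Tate instance `ThetaSetting.modelχq p 1 2` (Prop. 1.5 (ii)/(iii) THEOREMS there: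
  `prop15ii_etaleThetaDataχqInr`, `prop15iii_etaleThetaDataχqInr`), with Cor. 2.18 (ii) = abc-iut-L2-t10/abc-iut-L2's
  `DoubleUnderline.thetaEnvData_cor218_ii_of_H2` (binder-free there but for the printed 2-torsion condition `H2` on the
  cyclotome identification `μ`) and Cor. 2.18 (iv)-fibre = `DoubleUnderline.rigidData_cor218_iv_fibre_of_origin` with
  abc-iut-L2-t5's `ThetaSetting.modelχq_isEtThOrigin` / `hYcl_modelχq`; the [IUTchII] §1 setting is abc-iut-L6-d6's
  `ThetaSetting.ofDoubleUnderline C μ …` and `ModelAgreement` is bridge B8's `modelAgreement_ofThetaEnvData` (construction).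
Every other binder of the closers is kept VERBATIM and is DATA or structural: the Lemma 5.9 (iv) bi-theta isomorphism `i`,
the theta cocycle `hη`, `DK`, the `ModelFrame` `F`, the interface instance `Fr`, `ι`/`hi`, and for Prop. 1.3 (i)(ii) the
[AbsTopIII] comparison data `ψ`, `i₁`, `i₂`, `c₁`, `c₂` (the VALUE-IDENTIFICATION residual G-w4d042-1 lives in Prop. 1.3
(iii), not here).  The `ofDoubleUnderline` closers of Prop. 1.2 (ii) were already re-closed binder-free by abc-iut-w5-d233's
`exists_envOfFrobenioid_indeterminacy_modelTate` (p453435) — cited, not restated.  NOT re-closed here (reported NO-MATCH in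
the evidence TSV): `ofEnvIsoBiTheta_extCyc_eq_ker_toPiY`, whose extra binder F-0545 `EnvIsoBiTheta` has only toy closed
producers and which moreover pins `R : RigidData 𝔉.N l`.  Universes: both carriers live in `Type 0`.

HONEST FRAMING: re-closed-at-a-carrier ≠ proved-in-print; `modelχq` is a SEMI-SYNTHETIC Tate model of the typed [EtTh]
§1 interface (abc-iut-f-153's label), the §5 carrier is genuine modulo `hconst`/`hgc`; whether the DATA binders (`i`, …)
are jointly inhabited at this pair is not shown here (it is not a K4 question); typed ≠ discharged; no side taken on
[IUTchIII] Cor. 3.12; nothing here asserts that abc is proved or refuted. [claim: Mochizuki2012, status: disputed]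
-/

noncomputable section

namespace Literature.IUT.HodgeArakelov

open CategoryTheory Opposite Literature.AlgebraicGeometry.Frobenioids Literature.AnabelianGeometry.SemiGraphs
  Literature.AnabelianGeometry.SemiGraphs.GaloisObjects
open Literature.AnabelianGeometry.EtaleTheta Literature.AnabelianGeometry.EtaleTheta.SettingModel
open scoped Literature.AnabelianGeometry.EtaleTheta

universe v₀

section BiThetaFamily

/-! ### The §5 side: abc-iut-L2-t4's genuine [EtTh] §5 data over `B^temp(Π^tp_X)⁰` (`A_⊙^bs := Ÿ`), universes specialised to `0`
(variable block of `Discharge/Sec5FactsMembersOfConnectedTemperoidYdd.lean`, plus its `hconst` / `hgc` and the datum `DK`) -/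
variable {K : Type} [Field K] {X : Literature.AnabelianGeometry.SemiGraphs.TemperedArithmeticGroup.{0} K} {D₀ : Type} [Category.{v₀} D₀]
  {V : FrdIMonoidStub.{0}} {T₀ : RealifiedDivisorMonoids (D₀ := D₀) V}
  {VD : FrdICatStub.{1, 0, 0} (ConnectedPart (BTemp X.Pi))}
  {tf : TemperedFrobenioid T₀ (ConnectedPart (BTemp X.Pi)) VD} {hZ : tf.monoidType = MonoidType.Z}
  {hP : ∀ A : (ConnectedPart (BTemp X.Pi))ᵒᵖ, IsPerfect (tf.Φ.carrier A)}
  {NH : Subgroup (Field.absoluteGaloisGroup K) → tf.category → ℕ+ → Prop}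
  {lv N : ℕ+} {T : ThetaEnvData.{0} N} {ιX : T.PiX ≃ₜ* X.Pi}
  {pullFrac : ∀ {A A' : (BiKummerSetting.mkOfConnectedTemperoidYdd X tf hZ hP NH T ιX).C} (_ : A' ⟶ A),
    (BiKummerSetting.mkOfConnectedTemperoidYdd X tf hZ hP NH T ιX).biratUnits A →
      (BiKummerSetting.mkOfConnectedTemperoidYdd X tf hZ hP NH T ιX).biratUnits A'}
  {θ : (BiKummerSetting.mkOfConnectedTemperoidYdd X tf hZ hP NH T ιX).biratUnits
    (BiKummerSetting.mkOfConnectedTemperoidYdd X tf hZ hP NH T ιX).Aodot}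
  {Bl : (BiKummerSetting.mkOfConnectedTemperoidYdd X tf hZ hP NH T ιX).C}
  {Pl : (BiKummerSetting.mkOfConnectedTemperoidYdd X tf hZ hP NH T ιX).FractionPair θ Bl}
  {Rl : (BiKummerSetting.mkOfConnectedTemperoidYdd X tf hZ hP NH T ιX).NthRoot θ Pl lv pullFrac}
  (h : ModelFrobenioid.Hypotheses tf.divisorMonoid tf.ratFnFunctor)
  (Q : FrobenioidTheta.ThetaSubquotientStub.{0} (ConnectedPart (BTemp X.Pi))) (odd_l : Odd (lv : ℕ))
  (R : (BiKummerSetting.mkOfConnectedTemperoidYdd X tf hZ hP NH T ιX).NthRoot Rl.root Rl.pair N pullFrac)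
  (K' : Type) [Field K'] (constEmb : K'ˣ →* tf.biratUnitsModel R.BN) (constEmb_injective : Function.Injective constEmb)
  (hinvc : ∀ g : Aut R.AN.base,
    pull tf.divisorMonoid g.hom (ModelFrobenioid.div R.pair.num) = ModelFrobenioid.div R.pair.num)
  (hinvp : ∀ y : T.PiX, y ∈ T.PiYdd →
    pull tf.divisorMonoid ((BiKummerSetting.mkOfConnectedTemperoidYdd X tf hZ hP NH T ιX).galoisSurj R.AN.base
      R.αData.isGalois (ιX y)).hom (ModelFrobenioid.div R.pair.den) = ModelFrobenioid.div R.pair.den)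
  (hconst : ∀ (e : Aut R.BN) (k : K'ˣ), tf.biratAutModel R.BN e (constEmb k) = constEmb k)
  (hgc : ∀ u : (ThetaFrobenioid.ofConnectedTemperoidData h Q odd_l R ιX K' constEmb constEmb_injective hinvc hinvp).units
      (ThetaFrobenioid.ofConnectedTemperoidData h Q odd_l R ιX K' constEmb constEmb_injective hinvc hinvp).BN,
    (∀ y ∈ (ThetaFrobenioid.ofConnectedTemperoidData h Q odd_l R ιX K' constEmb constEmb_injective hinvc hinvp).imPiY,
      (ThetaFrobenioid.ofConnectedTemperoidData h Q odd_l R ιX K' constEmb constEmb_injective hinvc hinvp).sgpCap y *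
        (u : Aut (ThetaFrobenioid.ofConnectedTemperoidData h Q odd_l R ιX K' constEmb constEmb_injective hinvc hinvp).BN) *
        ((ThetaFrobenioid.ofConnectedTemperoidData h Q odd_l R ιX K' constEmb constEmb_injective hinvc hinvp).sgpCap y)⁻¹ = u) →
    (ThetaFrobenioid.ofConnectedTemperoidData h Q odd_l R ιX K' constEmb constEmb_injective hinvc hinvp).unitsToBirat
        (ThetaFrobenioid.ofConnectedTemperoidData h Q odd_l R ιX K' constEmb constEmb_injective hinvc hinvp).BN u ∈
      (ThetaFrobenioid.ofConnectedTemperoidData h Q odd_l R ιX K' constEmb constEmb_injective hinvc hinvp).constEmb.range)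
  (DK : Set (TopOut (ThetaFrobenioid.ofConnectedTemperoidData h Q odd_l R ιX K' constEmb constEmb_injective hinvc
    hinvp).EPiN))

/-! ### The §2 side: an `X̲̲`-choice over the étale-theta datum of record at the Tate instance (abc-iut-f-153's variables), a
cyclotome identification `μ` with the printed 2-torsion condition `H2`, cusp labels `L`, and the parameters of
abc-iut-L6-d6's [IUTchII] §1 setting `ThetaSetting.ofDoubleUnderline` -/
variable (p : ℕ) [Fact p.Prime] {l : ℕ} (C : (etaleThetaDataχqInr p).DoubleUnderline l) {N' : ℕ+}
  (μ : (ThetaSetting.modelχq p 1 2 even_two).CyclotomeMod l N')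
  (H2 : ∀ t : (ThetaSetting.modelχq p 1 2 even_two).lDeltaTheta l, t ^ 2 = 1 → μ.red t = 1)
  (L : C.CuspLabels) (hl : l.Prime) (hp2 : p ≠ 2) (hpl : p ≠ l)
  (hζ : ∃ ζ : (ThetaSetting.modelχq p 1 2 even_two).K, IsPrimitiveRoot ζ (4 * l))
  {η₀ : (C.thetaEnvData μ (compat_modelχq p 1 2 even_two) (ThetaSetting.modelχq_sec2Hyps p 1 2 even_two)).PiYdd →
    MuN p N'}
  (hη₀ : η₀ ∈ (C.thetaEnvData μ (compat_modelχq p 1 2 even_two)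
    (ThetaSetting.modelχq_sec2Hyps p 1 2 even_two)).thetaCocycles)

/-- **IUTchII:Prop1.2(ii) RE-CLOSED (C-R33), closer `envOfBiTheta_toEtale`** («the underlying [EtTh] datum of `M^Θ(𝒞)` is
`E^Π_N` on the nose», kurims p. 25–26): F-0542/F-0738/F-0543/F-0536 SUPPLIED at abc-iut-L2-t4's genuine §5 data
`ofConnectedTemperoidData …` by `lem58_lem59_ofConnectedTemperoidYddData` (structural `hconst`, `hgc`), `OuterActionLZ` by
`outerActionLZ_of`, F-0635 SUPPLIED at the Tate instance of record by `thetaEnvData_cor218_ii_of_H2` (structural `H2`);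
DATA binders `DK`, `hη`, `i` verbatim. ([IUTchII] Prop 1.2 (ii), kurims pp.25-26) [claim: Mochizuki2012, status: disputed] -/
theorem envOfBiTheta_toEtale_ofConnectedTemperoid_modelTate :
    let 𝔉₅ := ThetaFrobenioid.ofConnectedTemperoidData h Q odd_l R ιX K' constEmb constEmb_injective hinvc hinvp
    let hf := ThetaFrobenioid.lem58_lem59_ofConnectedTemperoidYddData h Q odd_l R K' constEmb constEmb_injective hinvc
      hinvp hconst hgc
    let h3 := ThetaFrobenioid.outerActionLZ_of 𝔉₅
    let Rχ := C.rigidData μ (compat_modelχq p 1 2 even_two) (ThetaSetting.modelχq_sec2Hyps p 1 2 even_two)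
      (prop15iii_etaleThetaDataχqInr p (compat_modelχq p 1 2 even_two)) L
    let h218 := C.thetaEnvData_cor218_ii_of_H2 μ (compat_modelχq p 1 2 even_two)
      (ThetaSetting.modelχq_sec2Hyps p 1 2 even_two) (prop15iii_etaleThetaDataχqInr p (compat_modelχq p 1 2 even_two))
      (prop15ii_etaleThetaDataχqInr p (compat_modelχq p 1 2 even_two)) H2
    let A := ThetaSetting.modelAgreement_ofThetaEnvData Rχ.toThetaEnvData
      (ThetaSetting.SideData.ofDoubleUnderline C μ (compat_modelχq p 1 2 even_two)
        (ThetaSetting.modelχq_sec2Hyps p 1 2 even_two) hl hp2 hpl hζ hη₀)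
    ∀ {η : Rχ.PiYdd → Rχ.mu} (hη : η ∈ Rχ.thetaCocycles)
      (i : (𝔉₅.frdBiThetaEnv hf.2.1 h3 hf.2.2.2.1 hf.2.2.2.2 hf.1 DK).Iso (Rχ.toThetaEnvData.modelBi hη)),
      (envOfBiTheta 𝔉₅ hf.2.1 h3 hf.2.2.2.1 hf.2.2.2.2 hf.1 DK h218 A hη i).toEtale =
        𝔉₅.frdMonoThetaEnv hf.2.1 h3 hf.2.2.2.1 hf.2.2.2.2 hf.1 DK := by
  intro 𝔉₅ hf h3 Rχ h218 A η hη i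
  exact envOfBiTheta_toEtale 𝔉₅ _ _ _ _ _ DK h218 A hη i

/-- **IUTchII:Prop1.3(i) RE-CLOSED (C-R33), closer `mem_ofBiTheta_extCyc_iff`** («the exterior cyclotome `Π_μ(M^Θ(𝒞))`
corresponds to `μ_N(S)`», kurims p. 26: membership in the exterior cyclotome ⟺ trivial image in `Π^tp_Y̲`) at the same
pair of carriers; remaining binders DATA/structural (`F`, `Fr`, `ι`, `hi`, …). ([IUTchII] Prop 1.3 (i), kurims p.26)
[claim: Mochizuki2012, status: disputed] -/
theorem mem_ofBiTheta_extCyc_iff_ofConnectedTemperoid_modelTate :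
    let 𝔉₅ := ThetaFrobenioid.ofConnectedTemperoidData h Q odd_l R ιX K' constEmb constEmb_injective hinvc hinvp
    let hf := ThetaFrobenioid.lem58_lem59_ofConnectedTemperoidYddData h Q odd_l R K' constEmb constEmb_injective hinvc
      hinvp hconst hgc
    let h3 := ThetaFrobenioid.outerActionLZ_of 𝔉₅
    let Rχ := C.rigidData μ (compat_modelχq p 1 2 even_two) (ThetaSetting.modelχq_sec2Hyps p 1 2 even_two)
      (prop15iii_etaleThetaDataχqInr p (compat_modelχq p 1 2 even_two)) L
    let h218 := C.thetaEnvData_cor218_ii_of_H2 μ (compat_modelχq p 1 2 even_two)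
      (ThetaSetting.modelχq_sec2Hyps p 1 2 even_two) (prop15iii_etaleThetaDataχqInr p (compat_modelχq p 1 2 even_two))
      (prop15ii_etaleThetaDataχqInr p (compat_modelχq p 1 2 even_two)) H2
    let A := ThetaSetting.modelAgreement_ofThetaEnvData Rχ.toThetaEnvData
      (ThetaSetting.SideData.ofDoubleUnderline C μ (compat_modelχq p 1 2 even_two)
        (ThetaSetting.modelχq_sec2Hyps p 1 2 even_two) hl hp2 hpl hζ hη₀)
    ∀ {η : Rχ.PiYdd → Rχ.mu} (hη : η ∈ Rχ.thetaCocycles)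
      (i : (𝔉₅.frdBiThetaEnv hf.2.1 h3 hf.2.2.2.1 hf.2.2.2.2 hf.1 DK).Iso (Rχ.toThetaEnvData.modelBi hη))
      (F : ModelFrame (ThetaSetting.ofDoubleUnderline C μ (compat_modelχq p 1 2 even_two)
        (ThetaSetting.modelχq_sec2Hyps p 1 2 even_two) hl hp2 hpl hζ hη₀) Rχ)
      (Fr : TemperedFrobenioidData
        (ThetaSetting.ofDoubleUnderline C μ (compat_modelχq p 1 2 even_two)
        (ThetaSetting.modelχq_sec2Hyps p 1 2 even_two) hl hp2 hpl hζ hη₀))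
      (ι : 𝔉₅.PiX ≃ₜ* Rχ.PiX)
      (hi : ∀ x : 𝔉₅.EPiN, ((CycEnvelope.proj Rχ.augY Rχ.chi (i.e x) : Rχ.PiY) : Rχ.PiX) = ι (𝔉₅.toPiY x)) (x : 𝔉₅.EPiN),
      x ∈ (EnvOfFrobenioid.ofBiTheta 𝔉₅ hf.2.1 h3 hf.2.2.2.1 hf.2.2.2.2 hf.1 DK h218 A hη i F Fr).recon.extCyc ↔ 𝔉₅.toPiY x = 1 := by
  intro 𝔉₅ hf h3 Rχ h218 A η hη i F Fr ι hi x
  exact mem_ofBiTheta_extCyc_iff 𝔉₅ _ _ _ _ _ DK h218 A hη i F Fr ι hi x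

/-- **IUTchII:Prop1.3(i) RE-CLOSED (C-R33), closer `muIncl_corrExtOfBiTheta`** (the canonical exterior correspondence
`Π_μ(M^Θ(𝒞)) ⥲ μ_N(B_N)` is inverse to `u ↦ (u, 1)`, kurims p. 26) at the same pair of carriers.
([IUTchII] Prop 1.3 (i), kurims p.26) [claim: Mochizuki2012, status: disputed] -/
theorem muIncl_corrExtOfBiTheta_ofConnectedTemperoid_modelTate :
    let 𝔉₅ := ThetaFrobenioid.ofConnectedTemperoidData h Q odd_l R ιX K' constEmb constEmb_injective hinvc hinvp
    let hf := ThetaFrobenioid.lem58_lem59_ofConnectedTemperoidYddData h Q odd_l R K' constEmb constEmb_injective hinvc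
      hinvp hconst hgc
    let h3 := ThetaFrobenioid.outerActionLZ_of 𝔉₅
    let Rχ := C.rigidData μ (compat_modelχq p 1 2 even_two) (ThetaSetting.modelχq_sec2Hyps p 1 2 even_two)
      (prop15iii_etaleThetaDataχqInr p (compat_modelχq p 1 2 even_two)) L
    let h218 := C.thetaEnvData_cor218_ii_of_H2 μ (compat_modelχq p 1 2 even_two)
      (ThetaSetting.modelχq_sec2Hyps p 1 2 even_two) (prop15iii_etaleThetaDataχqInr p (compat_modelχq p 1 2 even_two))
      (prop15ii_etaleThetaDataχqInr p (compat_modelχq p 1 2 even_two)) H2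
    let A := ThetaSetting.modelAgreement_ofThetaEnvData Rχ.toThetaEnvData
      (ThetaSetting.SideData.ofDoubleUnderline C μ (compat_modelχq p 1 2 even_two)
        (ThetaSetting.modelχq_sec2Hyps p 1 2 even_two) hl hp2 hpl hζ hη₀)
    ∀ {η : Rχ.PiYdd → Rχ.mu} (hη : η ∈ Rχ.thetaCocycles)
      (i : (𝔉₅.frdBiThetaEnv hf.2.1 h3 hf.2.2.2.1 hf.2.2.2.2 hf.1 DK).Iso (Rχ.toThetaEnvData.modelBi hη))
      (F : ModelFrame (ThetaSetting.ofDoubleUnderline C μ (compat_modelχq p 1 2 even_two)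
        (ThetaSetting.modelχq_sec2Hyps p 1 2 even_two) hl hp2 hpl hζ hη₀) Rχ)
      (Fr : TemperedFrobenioidData
        (ThetaSetting.ofDoubleUnderline C μ (compat_modelχq p 1 2 even_two)
        (ThetaSetting.modelχq_sec2Hyps p 1 2 even_two) hl hp2 hpl hζ hη₀))
      (ι : 𝔉₅.PiX ≃ₜ* Rχ.PiX)
      (hi : ∀ x : 𝔉₅.EPiN, ((CycEnvelope.proj Rχ.augY Rχ.chi (i.e x) : Rχ.PiY) : Rχ.PiX) = ι (𝔉₅.toPiY x))
      (x : (EnvOfFrobenioid.ofBiTheta 𝔉₅ hf.2.1 h3 hf.2.2.2.1 hf.2.2.2.2 hf.1 DK h218 A hη i F Fr).recon.extCyc),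
      𝔉₅.muIncl (corrExtOfBiTheta 𝔉₅ hf.2.1 h3 hf.2.2.2.1 hf.2.2.2.2 hf.1 DK h218 A hη i F Fr ι hi x) = x.1 := by
  intro 𝔉₅ hf h3 Rχ h218 A η hη i F Fr ι hi x
  exact muIncl_corrExtOfBiTheta 𝔉₅ _ _ _ _ _ DK h218 A hη i F Fr ι hi x

/-- **IUTchII:Prop1.3(i) RE-CLOSED (C-R33), closer `ofBiTheta_extCyc_eq_ker_toPiY`** (`Π_μ(M^Θ(𝒞)) = Ker(E^Π_N ↠ Π^tp_Y̲)`,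
[EtTh] Rmk. 5.10.3; kurims II p. 26) at the same pair of carriers. ([IUTchII] Prop 1.3 (i), kurims p.26)
[claim: Mochizuki2012, status: disputed] -/
theorem ofBiTheta_extCyc_eq_ker_toPiY_ofConnectedTemperoid_modelTate :
    let 𝔉₅ := ThetaFrobenioid.ofConnectedTemperoidData h Q odd_l R ιX K' constEmb constEmb_injective hinvc hinvp
    let hf := ThetaFrobenioid.lem58_lem59_ofConnectedTemperoidYddData h Q odd_l R K' constEmb constEmb_injective hinvc
      hinvp hconst hgc
    let h3 := ThetaFrobenioid.outerActionLZ_of 𝔉₅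
    let Rχ := C.rigidData μ (compat_modelχq p 1 2 even_two) (ThetaSetting.modelχq_sec2Hyps p 1 2 even_two)
      (prop15iii_etaleThetaDataχqInr p (compat_modelχq p 1 2 even_two)) L
    let h218 := C.thetaEnvData_cor218_ii_of_H2 μ (compat_modelχq p 1 2 even_two)
      (ThetaSetting.modelχq_sec2Hyps p 1 2 even_two) (prop15iii_etaleThetaDataχqInr p (compat_modelχq p 1 2 even_two))
      (prop15ii_etaleThetaDataχqInr p (compat_modelχq p 1 2 even_two)) H2
    let A := ThetaSetting.modelAgreement_ofThetaEnvData Rχ.toThetaEnvData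
      (ThetaSetting.SideData.ofDoubleUnderline C μ (compat_modelχq p 1 2 even_two)
        (ThetaSetting.modelχq_sec2Hyps p 1 2 even_two) hl hp2 hpl hζ hη₀)
    ∀ {η : Rχ.PiYdd → Rχ.mu} (hη : η ∈ Rχ.thetaCocycles)
      (i : (𝔉₅.frdBiThetaEnv hf.2.1 h3 hf.2.2.2.1 hf.2.2.2.2 hf.1 DK).Iso (Rχ.toThetaEnvData.modelBi hη))
      (F : ModelFrame (ThetaSetting.ofDoubleUnderline C μ (compat_modelχq p 1 2 even_two)
        (ThetaSetting.modelχq_sec2Hyps p 1 2 even_two) hl hp2 hpl hζ hη₀) Rχ)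
      (Fr : TemperedFrobenioidData
        (ThetaSetting.ofDoubleUnderline C μ (compat_modelχq p 1 2 even_two)
        (ThetaSetting.modelχq_sec2Hyps p 1 2 even_two) hl hp2 hpl hζ hη₀))
      (ι : 𝔉₅.PiX ≃ₜ* Rχ.PiX)
      (hi : ∀ x : 𝔉₅.EPiN, ((CycEnvelope.proj Rχ.augY Rχ.chi (i.e x) : Rχ.PiY) : Rχ.PiX) = ι (𝔉₅.toPiY x)),
      (EnvOfFrobenioid.ofBiTheta 𝔉₅ hf.2.1 h3 hf.2.2.2.1 hf.2.2.2.2 hf.1 DK h218 A hη i F Fr).recon.extCyc = 𝔉₅.toPiY.ker := by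
  intro 𝔉₅ hf h3 Rχ h218 A η hη i F Fr ι hi
  exact ofBiTheta_extCyc_eq_ker_toPiY 𝔉₅ _ _ _ _ _ DK h218 A hη i F Fr ι hi

/-- **IUTchII:Prop1.3(i) RE-CLOSED (C-R33), closer `ofBiTheta_extCyc_eq_range_muIncl`** (`Π_μ(M^Θ(𝒞))` = the image of
`μ_N(B_N) ↪ E^Π_N`, kurims II p. 26) at the same pair of carriers. ([IUTchII] Prop 1.3 (i), kurims p.26)
[claim: Mochizuki2012, status: disputed] -/
theorem ofBiTheta_extCyc_eq_range_muIncl_ofConnectedTemperoid_modelTate :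
    let 𝔉₅ := ThetaFrobenioid.ofConnectedTemperoidData h Q odd_l R ιX K' constEmb constEmb_injective hinvc hinvp
    let hf := ThetaFrobenioid.lem58_lem59_ofConnectedTemperoidYddData h Q odd_l R K' constEmb constEmb_injective hinvc
      hinvp hconst hgc
    let h3 := ThetaFrobenioid.outerActionLZ_of 𝔉₅
    let Rχ := C.rigidData μ (compat_modelχq p 1 2 even_two) (ThetaSetting.modelχq_sec2Hyps p 1 2 even_two)
      (prop15iii_etaleThetaDataχqInr p (compat_modelχq p 1 2 even_two)) L
    let h218 := C.thetaEnvData_cor218_ii_of_H2 μ (compat_modelχq p 1 2 even_two)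
      (ThetaSetting.modelχq_sec2Hyps p 1 2 even_two) (prop15iii_etaleThetaDataχqInr p (compat_modelχq p 1 2 even_two))
      (prop15ii_etaleThetaDataχqInr p (compat_modelχq p 1 2 even_two)) H2
    let A := ThetaSetting.modelAgreement_ofThetaEnvData Rχ.toThetaEnvData
      (ThetaSetting.SideData.ofDoubleUnderline C μ (compat_modelχq p 1 2 even_two)
        (ThetaSetting.modelχq_sec2Hyps p 1 2 even_two) hl hp2 hpl hζ hη₀)
    ∀ {η : Rχ.PiYdd → Rχ.mu} (hη : η ∈ Rχ.thetaCocycles)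
      (i : (𝔉₅.frdBiThetaEnv hf.2.1 h3 hf.2.2.2.1 hf.2.2.2.2 hf.1 DK).Iso (Rχ.toThetaEnvData.modelBi hη))
      (F : ModelFrame (ThetaSetting.ofDoubleUnderline C μ (compat_modelχq p 1 2 even_two)
        (ThetaSetting.modelχq_sec2Hyps p 1 2 even_two) hl hp2 hpl hζ hη₀) Rχ)
      (Fr : TemperedFrobenioidData
        (ThetaSetting.ofDoubleUnderline C μ (compat_modelχq p 1 2 even_two)
        (ThetaSetting.modelχq_sec2Hyps p 1 2 even_two) hl hp2 hpl hζ hη₀))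
      (ι : 𝔉₅.PiX ≃ₜ* Rχ.PiX)
      (hi : ∀ x : 𝔉₅.EPiN, ((CycEnvelope.proj Rχ.augY Rχ.chi (i.e x) : Rχ.PiY) : Rχ.PiX) = ι (𝔉₅.toPiY x)),
      (EnvOfFrobenioid.ofBiTheta 𝔉₅ hf.2.1 h3 hf.2.2.2.1 hf.2.2.2.2 hf.1 DK h218 A hη i F Fr).recon.extCyc = 𝔉₅.muIncl.range := by
  intro 𝔉₅ hf h3 Rχ h218 A η hη i F Fr ι hi
  exact ofBiTheta_extCyc_eq_range_muIncl 𝔉₅ _ _ _ _ _ DK h218 A hη i F Fr ι hi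

/-- **IUTchII:Prop1.3(i)–(ii) RE-CLOSED (C-R33), closer `prop13_i_ii_ofBiTheta`** (abc-iut-L6-t1's `Prop13_i_ii` for the
genuine `M^Θ(𝒞)` over the interface instance `TemperedFrobenioidData.ofThetaFrobenioid`, kurims p. 26) at the same pair of
carriers; the [AbsTopIII] comparison DATA `ψ`, `i₁` (Cor. 1.10 (c)), `i₂` (Rmk. 3.2.1), `c₁`, `c₂` and `e`, `Pj` stay binders
(not FACT rows; the value-identification residual G-w4d042-1 belongs to Prop. 1.3 (iii)). ([IUTchII] Prop 1.3 (i)(ii), kurims p.26)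
[claim: Mochizuki2012, status: disputed] -/
theorem prop13_i_ii_ofBiTheta_ofConnectedTemperoid_modelTate :
    let 𝔉₅ := ThetaFrobenioid.ofConnectedTemperoidData h Q odd_l R ιX K' constEmb constEmb_injective hinvc hinvp
    let hf := ThetaFrobenioid.lem58_lem59_ofConnectedTemperoidYddData h Q odd_l R K' constEmb constEmb_injective hinvc
      hinvp hconst hgc
    let h3 := ThetaFrobenioid.outerActionLZ_of 𝔉₅
    let Rχ := C.rigidData μ (compat_modelχq p 1 2 even_two) (ThetaSetting.modelχq_sec2Hyps p 1 2 even_two)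
      (prop15iii_etaleThetaDataχqInr p (compat_modelχq p 1 2 even_two)) L
    let h218 := C.thetaEnvData_cor218_ii_of_H2 μ (compat_modelχq p 1 2 even_two)
      (ThetaSetting.modelχq_sec2Hyps p 1 2 even_two) (prop15iii_etaleThetaDataχqInr p (compat_modelχq p 1 2 even_two))
      (prop15ii_etaleThetaDataχqInr p (compat_modelχq p 1 2 even_two)) H2
    let A := ThetaSetting.modelAgreement_ofThetaEnvData Rχ.toThetaEnvData
      (ThetaSetting.SideData.ofDoubleUnderline C μ (compat_modelχq p 1 2 even_two)
        (ThetaSetting.modelχq_sec2Hyps p 1 2 even_two) hl hp2 hpl hζ hη₀)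
    ∀ {η : Rχ.PiYdd → Rχ.mu} (hη : η ∈ Rχ.thetaCocycles)
      (i : (𝔉₅.frdBiThetaEnv hf.2.1 h3 hf.2.2.2.1 hf.2.2.2.2 hf.1 DK).Iso (Rχ.toThetaEnvData.modelBi hη))
      (F : ModelFrame (ThetaSetting.ofDoubleUnderline C μ (compat_modelχq p 1 2 even_two)
        (ThetaSetting.modelχq_sec2Hyps p 1 2 even_two) hl hp2 hpl hζ hη₀) Rχ)
      (ι : 𝔉₅.PiX ≃ₜ* Rχ.PiX)
      (hi : ∀ x : 𝔉₅.EPiN, ((CycEnvelope.proj Rχ.augY Rχ.chi (i.e x) : Rχ.PiY) : Rχ.PiX) = ι (𝔉₅.toPiY x))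
      (e : ConnectedPart (BTemp X.Pi) ≌ BTemp0
        (ThetaSetting.ofDoubleUnderline C μ (compat_modelχq p 1 2 even_two)
        (ThetaSetting.modelχq_sec2Hyps p 1 2 even_two) hl hp2 hpl hζ hη₀).PiX)
      (Pj : FrobenioidCyclotomicRigidity.ThetaSubquotientProj 𝔉₅)
      (ψ : ModPow (ModelCyclotomes.intCyc Rχ).carrier
        ((ThetaSetting.ofDoubleUnderline C μ (compat_modelχq p 1 2 even_two)
        (ThetaSetting.modelχq_sec2Hyps p 1 2 even_two) hl hp2 hpl hζ hη₀).N : ℕ) ≃* 𝔉₅.lDeltaModN 𝔉₅.BN)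
      {MTM Gc PX : Type} [Group MTM] [Group Gc] [Group PX]
      (i₁ : Gc ≃* PX) (i₂ : MTM ≃* Gc) (c₁ : 𝔉₅.muTorsion 𝔉₅.BN 𝔉₅.N ≃* MTM) (c₂ : 𝔉₅.lDeltaModN 𝔉₅.BN ≃* PX),
      Prop13_i_ii (EnvOfFrobenioid.ofBiTheta 𝔉₅ hf.2.1 h3 hf.2.2.2.1 hf.2.2.2.2 hf.1 DK h218 A hη i F
        (TemperedFrobenioidData.ofThetaFrobenioid
          (ThetaSetting.ofDoubleUnderline C μ (compat_modelχq p 1 2 even_two)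
        (ThetaSetting.modelχq_sec2Hyps p 1 2 even_two) hl hp2 hpl hζ hη₀) 𝔉₅ e)) := by
  intro 𝔉₅ hf h3 Rχ h218 A η hη i F ι hi e Pj ψ MTM Gc PX _ _ _ i₁ i₂ c₁ c₂
  exact prop13_i_ii_ofBiTheta 𝔉₅ _ _ _ _ _ DK h218 A hη i F ι hi e Pj ψ i₁ i₂ c₁ c₂

include H2 in
/-- **IUTchII:Prop1.2(ii) RE-CLOSED (C-R33), closer `exists_envOfFrobenioid_of_isMonoThetaEnv`** («an `EnvOfFrobenioid Fr`
with `M^Θ(𝒞) = M` whose Def. 1.1 (i) output has the Prop. 1.2 (i) indeterminacy», kurims pp. 25–26) at the Tate instance of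
record: F-0635 by `thetaEnvData_cor218_ii_of_H2` (structural `H2`), F-0624 by `rigidData_cor218_iv_fibre_of_origin` with
abc-iut-L2-t5's `ThetaSetting.modelχq_isEtThOrigin` / `hYcl_modelχq`; the `ModelFrame` `F`, the environment `M'` with
`hM'`, and `Fr` stay binders (cf. abc-iut-w5-d233's binder-free `exists_envOfFrobenioid_indeterminacy_modelTate`, p453435,
for the sister closer). ([IUTchII] Prop 1.2 (ii), kurims pp.25-26) [claim: Mochizuki2012, status: disputed] -/
theorem exists_envOfFrobenioid_of_isMonoThetaEnv_modelTate :
    let Rχ := C.rigidData μ (compat_modelχq p 1 2 even_two) (ThetaSetting.modelχq_sec2Hyps p 1 2 even_two)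
      (prop15iii_etaleThetaDataχqInr p (compat_modelχq p 1 2 even_two)) L
    ∀ (F : ModelFrame (ThetaSetting.ofDoubleUnderline C μ (compat_modelχq p 1 2 even_two)
        (ThetaSetting.modelχq_sec2Hyps p 1 2 even_two) hl hp2 hpl hζ hη₀) Rχ)
      (M' : Literature.AnabelianGeometry.EtaleTheta.MonoThetaEnv) (hM' : Rχ.toThetaEnvData.IsMonoThetaEnv M')
      (Fr : TemperedFrobenioidData
        (ThetaSetting.ofDoubleUnderline C μ (compat_modelχq p 1 2 even_two)
        (ThetaSetting.modelχq_sec2Hyps p 1 2 even_two) hl hp2 hpl hζ hη₀)),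
      ∃ E : EnvOfFrobenioid Fr, E.env.toEtale = M' ∧ Prop12_i_indeterminacy E.recon := by
  intro Rχ F M' hM' Fr
  exact exists_envOfFrobenioid_of_isMonoThetaEnv F
    (ThetaSetting.modelAgreement_ofThetaEnvData Rχ.toThetaEnvData
      (ThetaSetting.SideData.ofDoubleUnderline C μ (compat_modelχq p 1 2 even_two)
        (ThetaSetting.modelχq_sec2Hyps p 1 2 even_two) hl hp2 hpl hζ hη₀))
    (C.thetaEnvData_cor218_ii_of_H2 μ (compat_modelχq p 1 2 even_two) (ThetaSetting.modelχq_sec2Hyps p 1 2 even_two)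
      (prop15iii_etaleThetaDataχqInr p (compat_modelχq p 1 2 even_two))
      (prop15ii_etaleThetaDataχqInr p (compat_modelχq p 1 2 even_two)) H2)
    (C.rigidData_cor218_iv_fibre_of_origin μ (compat_modelχq p 1 2 even_two) (ThetaSetting.modelχq_sec2Hyps p 1 2 even_two)
      (prop15iii_etaleThetaDataχqInr p (compat_modelχq p 1 2 even_two)) L
      (ThetaSetting.modelχq_isEtThOrigin p 1 2 even_two) (hYcl_modelχq p 1 2 even_two))
    M' hM' Fr

end BiThetaFamily

end Literature.IUT.HodgeArakelov

end
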